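import Literature.Computability.Complexity.OneInThreeSATGadget
import Literature.Computability.Complexity.KSATReductions
import Literature.Computability.Complexity.ClayProblemProofs
import HarnessLib

/-!
# `3SAT ≤ₚ ONE-IN-THREE 3SAT`, the machine half, and the discharge of
`Schaefer1978_oneInThreeSAT_NPHard`

Garey–Johnson [LO4] (p. 259; Schaefer 1978): ONE-IN-THREE 3SAT is NP-complete by a
"Transformation from 3SAT". `OneInThreeSATGadget.lean` proves the formula-level transformation
`OneInThree.reduce B φ` correct (`xSatisfiable_reduce_iff`, `isThreeLiteralClauses_reduce`); this
file computes it on codes in polynomial time and assembles the Karp reduction: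

* `OneInThree.reduceFn ∈ FP` with `decCNF (reduceFn w) = reduce 2^{|w|+1} (decCNF w)` on EVERY
  string (`decCNF_reduceFn_eq_reduce`), the fresh block `B = 2^{|w|+1}` lying above every variable
  value a string of length `|w|` can denote (`Ladder3.decCNF_vars_lt`);
* `OneInThree.toX3SATFn` — the guarded map (`KSATRed.isCanonFn ∧ KSATRed.widthLEFn 3` ? the
  canonical re-encoding of `reduceFn w` : `KSATRed.badCode`), `toX3SATFn_mem_FP`;
* **`OneInThree.kSAT_three_karpReducible_ONEIN3SAT : kSAT 3 ≤ₚ ONEIN3SAT`** and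
  **`Schaefer1978_oneInThreeSAT_NPHard_holds`** from the tree's `isNPComplete_kSAT_three_holds`
  (Arora–Barak Thm. 2.10 (2), `ClayProblemProofs.lean`) and `IsHard.of_reducible_holds`.

## The machine (a simplified clone of `Ladder3.reduceFn`, `ParsimoniousThreeCNFMachine.lean`)

No machine is written; everything is brick algebra. On input `w` with `m = |fstF w|` announced
clauses, the raw clause item `aᵢ = fstF (sndF^i (sndF w))` (`Ladder3.aOf`) announces `kᵢ =
|fstF aᵢ|` literals whose raw items are `u_{i,j} = fstF (sndF^j (sndF aᵢ))` (`uOf`). The three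
slots of `pad3` are the items `u_{i, min(j, kᵢ-1)}`, `j = 0, 1, 2` (`sOf`, `pad3_decClause_aOf`),
read BY INDEX (`HashBricks.nthItemFn` at the unary index `take j (tail (fstF aᵢ))`, `idxF`/`slotF`),
and `kᵢ = 0` (empty clause) is the one-bit test `isNilFn (fstF aᵢ)`. The fresh variable of slot
`j` of clause `i` is `B + 4i + j` with the numeral `Ladder3.freshFn ⟨w, ⌜4i+j⌝⟩` (`zF`,
`⌜4i+j⌝` by doubling `⌜i⌝ = lenBinF 1ⁱ` twice and adding `⌜j⌝`). The clause piece on `⟨w, 1ⁱ⟩` is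
the framed code of the three gadget clauses (`clausePiece`, value `clauseCodes`,
`clausePiece_boolPair`); the output is `⟨1^{3m}, clause fold⟩` with the LINEARLY clipped
concatenation fold `Brick.foldLoop appF (clipF Cpc clausePiece) X` (`AF`, unclipped on genuine
arguments by `length_clausePiece_le`), exactly three clauses per input clause
(`OneInThree.length_clauseGadget`).

## References

* [GareyJohnson1979] M. R. Garey, D. S. Johnson, *Computers and Intractability* (1979), [LO4]
  ONE-IN-THREE 3SAT, p. 259 ("Reference: [Schaefer, 1978b]. Transformation from 3SAT.").
* [Schaefer1978] T. J. Schaefer, *The complexity of satisfiability problems*, STOC 1978.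
* [AroraBarakCC2009] S. Arora, B. Barak, *Computational Complexity*, CUP 2009, §1.3 (polynomial
  time is closed under composition and bounded loops), §0.1 (codes of lists), Thm. 2.10 (2).
-/

noncomputable section

namespace Literature.Computability.Complexity

namespace OneInThree

open _root_.Computability Polynomial Brick HashBricks NegCNF Ladder3 Plumb
open scoped Notation

/-! ### Raw items of the input and the slots of `pad3` -/

/-- The raw literal item `j` of clause item `i` of `w`. [folklore] -/
def uOf (w : List Bool) (i j : ℕ) : List Bool := fstF (sndF^[j] (sndF (aOf w i)))

/-- The raw item of slot `j ∈ {0,1,2}` of clause `i`: item `min (j, kᵢ - 1)` (padding by repeating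
the last literal, as `pad3`). [folklore] -/
def sOf (w : List Bool) (i j : ℕ) : List Bool := uOf w i (min j (kOf w i - 1))

/-- The decoded clause `i` is the list of its `kᵢ` decoded literal items. [folklore] -/
theorem decClause_aOf (w : List Bool) (i : ℕ) :
    decClause (aOf w i) = decList decLit (kOf w i) (sndF (aOf w i)) := rfl

/-- **The slots of the decoded clause**: for `kᵢ ≠ 0`, `pad3` of the decoded clause `i` consists of
the decoded slot items. [folklore] -/
theorem pad3_decClause_aOf {w : List Bool} {i : ℕ} (hk : kOf w i ≠ 0) :
    pad3 (decClause (aOf w i)) = some (decLit (sOf w i 0), decLit (sOf w i 1), decLit (sOf w i 2)) := by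
  rw [decClause_aOf]
  unfold sOf uOf
  generalize sndF (aOf w i) = r
  match h : kOf w i with
  | 0 => exact absurd h hk
  | 1 =>
    simp only [decList, pad3, Nat.sub_self, Nat.min_zero, Function.iterate_zero, id_eq]
    rfl
  | 2 =>
    have e1 : min 1 (2 - 1) = 1 := by decide
    have e2 : min 2 (2 - 1) = 1 := by decide
    simp only [decList, pad3, e1, e2, Nat.zero_min, Function.iterate_zero, id_eq, Function.iterate_one]
    rfl
  | k + 3 =>
    have e0 : min 0 (k + 3 - 1) = 0 := Nat.zero_min _
    have e1 : min 1 (k + 3 - 1) = 1 := Nat.min_eq_left (by omega)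
    have e2 : min 2 (k + 3 - 1) = 2 := Nat.min_eq_left (by omega)
    rw [e0, e1, e2]
    simp only [decList, pad3, Function.iterate_zero, id_eq, Function.iterate_succ_apply',
      Option.some.injEq, Prod.mk.injEq]
    exact ⟨rfl, rfl, rfl⟩

/-- `kᵢ = 0` iff the header of clause item `i` is empty, iff the decoded clause is empty. [folklore] -/
theorem decClause_aOf_eq_nil_iff (w : List Bool) (i : ℕ) : decClause (aOf w i) = [] ↔ fstF (aOf w i) = [] := by
  rw [← List.length_eq_zero_iff, decClause_aOf, length_decList, kOf_eq, List.length_eq_zero_iff]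

/-! ### The pieces of the clause piece -/

/-- On `q = ⟨w, 1ⁱ⟩`: the raw header `fstF aᵢ` of clause item `i` (length `kᵢ`). [folklore] -/
def hdrF : List Bool → List Bool := fstF ∘ aF

/-- On `q`: the unary index `1^{min (j, kᵢ - 1)}` of slot `j` (`take j` of the tail of the header,
normalised to ones). [folklore] -/
def idxF (j : ℕ) : List Bool → List Bool :=
  onesFn ∘ takeFn ∘ fanoutFn (fun _ => ones j) (List.tail ∘ hdrF)

/-- On `q`: the raw item of slot `j` (`nthItemFn` at the index `idxF j` in the item list of `aᵢ`).
[folklore] -/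
def slotF (j : ℕ) : List Bool → List Bool := nthItemFn ∘ fanoutFn (idxF j) (sndF ∘ aF)

/-- On `q`: the numeral `⌜i⌝` (binary length of `1ⁱ`). [folklore] -/
def iNumF : List Bool → List Bool := lenBinF ∘ sndF

/-- On `q`: `⌜2i⌝`. [folklore] -/
def twoF : List Bool → List Bool := addFn ∘ fanoutFn iNumF iNumF

/-- On `q`: `⌜4i⌝`. [folklore] -/
def fourF : List Bool → List Bool := addFn ∘ fanoutFn twoF twoF

/-- On `q`: `⌜4i + j⌝`. [folklore] -/
def tNumF (j : ℕ) : List Bool → List Bool := addFn ∘ fanoutFn fourF (fun _ => encodeNat j)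

/-- On `q`: the fresh numeral of the variable `2^{|w|+1} + 4i + j` (`Ladder3.freshFn`). [folklore] -/
def zF (j : ℕ) : List Bool → List Bool := freshFn ∘ fanoutFn fstF (tNumF j)

/-- On `q`: the polarity bit of slot `j` (`headBitFn`, i.e. Mathlib's junk-tolerant `decodeBool`).
[folklore] -/
def polF (j : ℕ) : List Bool → List Bool := headBitFn ∘ sndF ∘ slotF j

/-- On `q`: the code of the literal of slot `j` (variable numeral copied, polarity re-encoded).
[folklore] -/
def posLitF (j : ℕ) : List Bool → List Bool := litCF (fstF ∘ slotF j) (polF j)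

/-- On `q`: the code of the NEGATED literal of slot `j` (polarity bit flipped). [folklore] -/
def negLitF (j : ℕ) : List Bool → List Bool := litCF (fstF ∘ slotF j) (notFn (polF j))

/-- On `q`: the code of the fresh literal `(2^{|w|+1} + 4i + j, b)`. [folklore] -/
def zLitF (j : ℕ) (b : Bool) : List Bool → List Bool := litCF (zF j) (fun _ => [b])

/-- On `q`: the framed codes of the three gadget clauses `R(¬ℓ₁, t, t+1)`, `R(ℓ₂, t+1, t+2)`,
`R(¬ℓ₃, t+2, t+3)` (`OneInThree.gadget`). [cite: GareyJohnson1979, LO4 (p. 259)] -/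
def gadgetPiece : List Bool → List Bool :=
  appendFn ∘ fanoutFn (frameF (cl3F (negLitF 0) (zLitF 0 true) (zLitF 1 true)))
    (appendFn ∘ fanoutFn (frameF (cl3F (posLitF 1) (zLitF 1 true) (zLitF 2 true)))
      (frameF (cl3F (negLitF 2) (zLitF 2 true) (zLitF 3 true))))

/-- On `q`: the framed codes of the three clauses of `OneInThree.unsatGadget`. [folklore] -/
def unsatPiece : List Bool → List Bool :=
  appendFn ∘ fanoutFn (frameF (cl3F (zLitF 0 true) (zLitF 1 true) (zLitF 2 true)))
    (appendFn ∘ fanoutFn (frameF (cl3F (zLitF 0 false) (zLitF 1 true) (zLitF 2 true)))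
      (frameF (cl3F (zLitF 0 true) (zLitF 1 true) (zLitF 2 true))))

/-- **The clause piece**: on `q = ⟨w, 1ⁱ⟩`, the framed codes of `clauseGadget B i cᵢ` — the
unsatisfiable gadget if the header of `aᵢ` is empty, the gadget of the three slots otherwise.
[cite: GareyJohnson1979, LO4 (p. 259)] -/
def clausePiece : List Bool → List Bool := iteFn (isNilFn ∘ hdrF) unsatPiece gadgetPiece

/-! ### Membership in `FP` of the pieces -/

/-- `hdrF ∈ FP`. [cite: AroraBarakCC2009, §1.3] -/
theorem hdrF_mem_FP : hdrF ∈ FP := comp_mem_FP fstF_mem_FP aF_mem_FP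

/-- `idxF j ∈ FP`. [cite: AroraBarakCC2009, §1.3] -/
theorem idxF_mem_FP (j : ℕ) : idxF j ∈ FP :=
  comp_mem_FP onesFn_mem_FP (comp_mem_FP takeFn_mem_FP (fanoutFn_mem_FP (const_mem_FP _)
    (comp_mem_FP PRelSigma.tail_mem_FP hdrF_mem_FP)))

/-- `slotF j ∈ FP`. [cite: AroraBarakCC2009, §1.3] -/
theorem slotF_mem_FP (j : ℕ) : slotF j ∈ FP :=
  comp_mem_FP nthItemFn_mem_FP (fanoutFn_mem_FP (idxF_mem_FP j) (comp_mem_FP sndF_mem_FP aF_mem_FP))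

/-- `iNumF ∈ FP`. [cite: AroraBarakCC2009, §1.3] -/
theorem iNumF_mem_FP : iNumF ∈ FP := comp_mem_FP lenBinF_mem_FP sndF_mem_FP

/-- `twoF ∈ FP`. [cite: AroraBarakCC2009, §1.3] -/
theorem twoF_mem_FP : twoF ∈ FP := comp_mem_FP addFn_mem_FP (fanoutFn_mem_FP iNumF_mem_FP iNumF_mem_FP)

/-- `fourF ∈ FP`. [cite: AroraBarakCC2009, §1.3] -/
theorem fourF_mem_FP : fourF ∈ FP := comp_mem_FP addFn_mem_FP (fanoutFn_mem_FP twoF_mem_FP twoF_mem_FP)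

/-- `tNumF j ∈ FP`. [cite: AroraBarakCC2009, §1.3] -/
theorem tNumF_mem_FP (j : ℕ) : tNumF j ∈ FP :=
  comp_mem_FP addFn_mem_FP (fanoutFn_mem_FP fourF_mem_FP (const_mem_FP _))

/-- `zF j ∈ FP`. [cite: AroraBarakCC2009, §1.3] -/
theorem zF_mem_FP (j : ℕ) : zF j ∈ FP :=
  comp_mem_FP freshFn_mem_FP (fanoutFn_mem_FP fstF_mem_FP (tNumF_mem_FP j))

/-- `polF j ∈ FP`. [cite: AroraBarakCC2009, §1.3] -/
theorem polF_mem_FP (j : ℕ) : polF j ∈ FP :=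
  comp_mem_FP headBitFn_mem_FP (comp_mem_FP sndF_mem_FP (slotF_mem_FP j))

/-- `posLitF j ∈ FP`. [cite: AroraBarakCC2009, §1.3] -/
theorem posLitF_mem_FP (j : ℕ) : posLitF j ∈ FP :=
  litCF_mem_FP (comp_mem_FP fstF_mem_FP (slotF_mem_FP j)) (polF_mem_FP j)

/-- `negLitF j ∈ FP`. [cite: AroraBarakCC2009, §1.3] -/
theorem negLitF_mem_FP (j : ℕ) : negLitF j ∈ FP :=
  litCF_mem_FP (comp_mem_FP fstF_mem_FP (slotF_mem_FP j)) (notFn_mem_FP (polF_mem_FP j))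

/-- `zLitF j b ∈ FP`. [cite: AroraBarakCC2009, §1.3] -/
theorem zLitF_mem_FP (j : ℕ) (b : Bool) : zLitF j b ∈ FP := litCF_mem_FP (zF_mem_FP j) (const_mem_FP _)

/-- `gadgetPiece ∈ FP`. [cite: AroraBarakCC2009, §1.3] -/
theorem gadgetPiece_mem_FP : gadgetPiece ∈ FP :=
  comp_mem_FP appendFn_mem_FP (fanoutFn_mem_FP
    (frameF_mem_FP (cl3F_mem_FP (negLitF_mem_FP 0) (zLitF_mem_FP 0 true) (zLitF_mem_FP 1 true)))
    (comp_mem_FP appendFn_mem_FP (fanoutFn_mem_FP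
      (frameF_mem_FP (cl3F_mem_FP (posLitF_mem_FP 1) (zLitF_mem_FP 1 true) (zLitF_mem_FP 2 true)))
      (frameF_mem_FP (cl3F_mem_FP (negLitF_mem_FP 2) (zLitF_mem_FP 2 true) (zLitF_mem_FP 3 true))))))

/-- `unsatPiece ∈ FP`. [cite: AroraBarakCC2009, §1.3] -/
theorem unsatPiece_mem_FP : unsatPiece ∈ FP :=
  comp_mem_FP appendFn_mem_FP (fanoutFn_mem_FP
    (frameF_mem_FP (cl3F_mem_FP (zLitF_mem_FP 0 true) (zLitF_mem_FP 1 true) (zLitF_mem_FP 2 true)))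
    (comp_mem_FP appendFn_mem_FP (fanoutFn_mem_FP
      (frameF_mem_FP (cl3F_mem_FP (zLitF_mem_FP 0 false) (zLitF_mem_FP 1 true) (zLitF_mem_FP 2 true)))
      (frameF_mem_FP (cl3F_mem_FP (zLitF_mem_FP 0 true) (zLitF_mem_FP 1 true) (zLitF_mem_FP 2 true))))))

/-- **`clausePiece ∈ FP`.** [cite: AroraBarakCC2009, §1.3] -/
theorem clausePiece_mem_FP : clausePiece ∈ FP :=
  iteFn_mem_FP (comp_mem_FP isNilFn_mem_FP hdrF_mem_FP) unsatPiece_mem_FP gadgetPiece_mem_FP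

/-! ### Values of the pieces on a genuine argument `⟨w, 1ⁱ⟩` -/

/-- `onesFn` is the run of ones of the length. [folklore] -/
theorem onesFn_eq_ones (x : List Bool) : onesFn x = ones x.length := unaryEncodeNat_eq_ones' _

/-- `aF ⟨w, 1ⁱ⟩ = aᵢ`. [folklore] -/
theorem aF_eq_aOf (w : List Bool) (i : ℕ) : aF (boolPair w (ones i)) = aOf w i := aF_boolPair w i

/-- `hdrF ⟨w, 1ⁱ⟩` is the raw header of `aᵢ`. [folklore] -/
theorem hdrF_boolPair (w : List Bool) (i : ℕ) : hdrF (boolPair w (ones i)) = fstF (aOf w i) := by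
  simp [hdrF, aF_eq_aOf]

/-- `idxF j ⟨w, 1ⁱ⟩ = 1^{min (j, kᵢ - 1)}`. [folklore] -/
theorem idxF_boolPair (w : List Bool) (i j : ℕ) :
    idxF j (boolPair w (ones i)) = ones (min j (kOf w i - 1)) := by
  simp only [idxF, Function.comp_apply, fanoutFn_apply, hdrF_boolPair, takeFn_boolPair, onesFn_eq_ones,
    List.length_take, List.length_replicate, List.length_tail, kOf_eq]

/-- `slotF j ⟨w, 1ⁱ⟩` is the raw slot item `sOf w i j`. [folklore] -/
theorem slotF_boolPair (w : List Bool) (i j : ℕ) : slotF j (boolPair w (ones i)) = sOf w i j := by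
  simp only [slotF, Function.comp_apply, fanoutFn_apply, idxF_boolPair, aF_eq_aOf, nthItemFn_boolPair,
    List.length_replicate, sOf, uOf]

/-- `iNumF ⟨w, 1ⁱ⟩ = ⌜i⌝`. [folklore] -/
theorem iNumF_boolPair (w : List Bool) (i : ℕ) : iNumF (boolPair w (ones i)) = encodeNat i := by
  simp [iNumF]

/-- `tNumF j ⟨w, 1ⁱ⟩ = ⌜4i + j⌝`. [folklore] -/
theorem tNumF_boolPair (w : List Bool) (i j : ℕ) : tNumF j (boolPair w (ones i)) = encodeNat (4 * i + j) := by
  simp only [tNumF, fourF, twoF, Function.comp_apply, fanoutFn_apply, iNumF_boolPair, addFn_boolPair,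
    bitsToNat_encodeNat]
  congr 1; omega

/-- The fresh numeral of slot `j` of clause `i`. [folklore] -/
def zNum (w : List Bool) (i j : ℕ) : List Bool := freshFn (boolPair w (encodeNat (4 * i + j)))

/-- `zF j ⟨w, 1ⁱ⟩ = zNum w i j`. [folklore] -/
theorem zF_boolPair (w : List Bool) (i j : ℕ) : zF j (boolPair w (ones i)) = zNum w i j := by
  simp only [zF, Function.comp_apply, fanoutFn_apply, fstF_boolPair, tNumF_boolPair, zNum]

/-- `polF j ⟨w, 1ⁱ⟩` is the polarity bit `decodeBool (sndF (sOf w i j))`. [folklore] -/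
theorem polF_boolPair (w : List Bool) (i j : ℕ) :
    polF j (boolPair w (ones i)) = [decodeBool (sndF (sOf w i j))] := by
  rw [polF, Function.comp_apply, Function.comp_apply, slotF_boolPair, CanonCode.headBitFn_eq_encodeBool_decodeBool]
  rfl

/-- The three clause codes of clause `i` in raw form (the value of the clause piece,
`clausePiece_boolPair`). [cite: GareyJohnson1979, LO4 (p. 259)] -/
def clauseCodes (w : List Bool) (i : ℕ) : List (List Bool) :=
  if fstF (aOf w i) = [] then
    [cl3 (litC (zNum w i 0) [true]) (litC (zNum w i 1) [true]) (litC (zNum w i 2) [true]),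
     cl3 (litC (zNum w i 0) [false]) (litC (zNum w i 1) [true]) (litC (zNum w i 2) [true]),
     cl3 (litC (zNum w i 0) [true]) (litC (zNum w i 1) [true]) (litC (zNum w i 2) [true])]
  else
    [cl3 (litC (fstF (sOf w i 0)) [!decodeBool (sndF (sOf w i 0))]) (litC (zNum w i 0) [true])
        (litC (zNum w i 1) [true]),
     cl3 (litC (fstF (sOf w i 1)) [decodeBool (sndF (sOf w i 1))]) (litC (zNum w i 1) [true])
        (litC (zNum w i 2) [true]),
     cl3 (litC (fstF (sOf w i 2)) [!decodeBool (sndF (sOf w i 2))]) (litC (zNum w i 2) [true])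
        (litC (zNum w i 3) [true])]

/-- Exactly three clause codes per input clause. [folklore] -/
@[simp] theorem length_clauseCodes (w : List Bool) (i : ℕ) : (clauseCodes w i).length = 3 := by
  unfold clauseCodes; split <;> rfl

/-- `gadgetPiece` on a genuine argument. [folklore] -/
theorem gadgetPiece_boolPair (w : List Bool) (i : ℕ) :
    gadgetPiece (boolPair w (ones i)) =
      encList [cl3 (litC (fstF (sOf w i 0)) [!decodeBool (sndF (sOf w i 0))]) (litC (zNum w i 0) [true])
          (litC (zNum w i 1) [true]),
        cl3 (litC (fstF (sOf w i 1)) [decodeBool (sndF (sOf w i 1))]) (litC (zNum w i 1) [true])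
          (litC (zNum w i 2) [true]),
        cl3 (litC (fstF (sOf w i 2)) [!decodeBool (sndF (sOf w i 2))]) (litC (zNum w i 2) [true])
          (litC (zNum w i 3) [true])] := by
  have hp0 := polF_boolPair w i 0
  have hp1 := polF_boolPair w i 1
  have hp2 := polF_boolPair w i 2
  simp only [gadgetPiece, posLitF, negLitF, zLitF, Function.comp_apply, fanoutFn_apply, appendFn_boolPair,
    frameF_apply, cl3F_apply, litCF_apply, notFn_apply hp0, notFn_apply hp2, hp1, slotF_boolPair, zF_boolPair,
    encList_cons_eq, encList_nil, List.append_nil]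

/-- `unsatPiece` on a genuine argument. [folklore] -/
theorem unsatPiece_boolPair (w : List Bool) (i : ℕ) :
    unsatPiece (boolPair w (ones i)) =
      encList [cl3 (litC (zNum w i 0) [true]) (litC (zNum w i 1) [true]) (litC (zNum w i 2) [true]),
        cl3 (litC (zNum w i 0) [false]) (litC (zNum w i 1) [true]) (litC (zNum w i 2) [true]),
        cl3 (litC (zNum w i 0) [true]) (litC (zNum w i 1) [true]) (litC (zNum w i 2) [true])] := by
  simp only [unsatPiece, zLitF, Function.comp_apply, fanoutFn_apply, appendFn_boolPair, frameF_apply,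
    cl3F_apply, litCF_apply, zF_boolPair, encList_cons_eq, encList_nil, List.append_nil]

/-- **Value of the clause piece** on a genuine argument `⟨w, 1ⁱ⟩`: the code of `clauseCodes w i`.
[folklore] -/
theorem clausePiece_boolPair (w : List Bool) (i : ℕ) :
    clausePiece (boolPair w (ones i)) = encList (clauseCodes w i) := by
  unfold clausePiece clauseCodes
  by_cases h : fstF (aOf w i) = []
  · have hc : (isNilFn ∘ hdrF) (boolPair w (ones i)) = [true] := by
      rw [Function.comp_apply, hdrF_boolPair, h]; rfl
    rw [iteFn_apply_true hc, if_pos h, unsatPiece_boolPair]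
  · have hc : (isNilFn ∘ hdrF) (boolPair w (ones i)) = [false] := by
      rw [Function.comp_apply, hdrF_boolPair, isNilFn]
      simp [h]
    rw [iteFn_apply_false hc, if_neg h, gadgetPiece_boolPair]

/-! ### Total length bounds -/

/-- Slot items are substrings of the input: `|fstF (sOf w i j)| ≤ |w|`. [folklore] -/
theorem length_fstF_sOf_le (w : List Bool) (i j : ℕ) : (fstF (sOf w i j)).length ≤ w.length :=
  (Lemma3FP.length_fstF_le _).trans ((Lemma3FP.length_fstF_le _).trans ((length_iterate_sndF_le _ _).trans
    ((Lemma3FP.length_sndF_le _).trans (length_aOf_le w i))))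

/-- **The fresh offsets fit**: for a genuine clause position `i < m` and `j ≤ 3`, the numeral
`⌜4i + j⌝` has length `≤ |w| + 1` (since `2m ≤ |w|`). [folklore] -/
theorem length_encodeNat_offset_le (w : List Bool) {i j : ℕ} (hi : i < (fstF w).length) (hj : j ≤ 3) :
    (encodeNat (4 * i + j)).length ≤ w.length + 1 := by
  rw [TM2Pass.length_encodeNat_eq_size, Nat.size_le]
  have h2 := length_fstF_sndF_le w
  have hp : w.length < 2 ^ w.length := Nat.lt_two_pow_self
  rw [pow_succ]
  omega

/-- Length of a fresh numeral: `|w| + 2`. [folklore] -/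
theorem length_zNum (w : List Bool) {i j : ℕ} (hi : i < (fstF w).length) (hj : j ≤ 3) :
    (zNum w i j).length = w.length + 2 :=
  length_freshFn_boolPair (length_encodeNat_offset_le w hi hj)

/-- Value of a fresh numeral: the canonical numeral of `2^{|w|+1} + 4i + j`. [folklore] -/
theorem zNum_eq (w : List Bool) {i j : ℕ} (hi : i < (fstF w).length) (hj : j ≤ 3) :
    zNum w i j = encodeNat (2 ^ (w.length + 1) + 4 * i + j) := by
  rw [zNum, freshFn_encodeNat (length_encodeNat_offset_le w hi hj), Nat.add_assoc]

/-- The clip constant of the clause fold. [folklore] -/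
def Cpc : ℕ := 400

/-- **Size of the clause piece on a genuine argument**: at most `Cpc (|w| + 1)` (so the linear
clip of the clause fold is harmless on the arguments folded). [folklore] -/
theorem length_clausePiece_le (w : List Bool) {i : ℕ} (hi : i < (fstF w).length) :
    (clausePiece (boolPair w (ones i))).length ≤ Cpc * (w.length + 1) := by
  have hz : ∀ j, j ≤ 3 → (zNum w i j).length = w.length + 2 := fun j hj => length_zNum w hi hj
  have hs := length_fstF_sOf_le w i
  rw [clausePiece_boolPair, clauseCodes]
  split
  · simp only [encList_cons_eq, encList_nil, List.append_nil, List.length_append, length_frame, length_cl3,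
      length_litC, List.length_singleton, hz 0 (by omega), hz 1 (by omega), hz 2 (by omega), Cpc]
    omega
  · simp only [encList_cons_eq, encList_nil, List.append_nil, List.length_append, length_frame, length_cl3,
      length_litC, List.length_singleton, hz 0 (by omega), hz 1 (by omega), hz 2 (by omega), hz 3 (by omega),
      Cpc]
    have h0 := hs 0; have h1 := hs 1; have h2 := hs 2
    omega

/-! ### The output: header, clause fold, the map on codes -/

/-- **The clause fold**: `Brick.foldLoop appF (clipF Cpc clausePiece) X` from `Ladder3.outInit` — the
framed codes of all gadget clauses, clause by clause. [cite: AroraBarakCC2009, §1.3] -/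
def AF : List Bool → List Bool := sndPow 2 ∘ foldLoop appF (clipF Cpc clausePiece) X ∘ outInit

/-- **The header**: `1^{3m}` — three output clauses per input clause. [folklore] -/
def UF : List Bool → List Bool := onesFn ∘ appendFn ∘ fanoutFn fstF (appendFn ∘ fanoutFn fstF fstF)

/-- **The transformation `3SAT → ONE-IN-THREE 3SAT` on codes**: `w ↦ ⟨1^{3m}, clause fold⟩`, a
string decoding (by the total decoder `NegCNF.decCNF`) to `OneInThree.reduce 2^{|w|+1} (decCNF w)`
(`decCNF_reduceFn_eq_reduce`). [cite: GareyJohnson1979, LO4 (p. 259)] -/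
def reduceFn : List Bool → List Bool := fanoutFn UF AF

/-- `AF ∈ FP` (`foldLoop_clipF_mem_FP`). [cite: AroraBarakCC2009, §1.3] -/
theorem AF_mem_FP : AF ∈ FP :=
  comp_mem_FP (sndPow_mem_FP 2) (comp_mem_FP
    (foldLoop_clipF_mem_FP Cpc appF_mem_FP length_appF_le clausePiece_mem_FP _) outInit_mem_FP)

/-- `UF ∈ FP`. [cite: AroraBarakCC2009, §1.3] -/
theorem UF_mem_FP : UF ∈ FP :=
  comp_mem_FP onesFn_mem_FP (comp_mem_FP appendFn_mem_FP (fanoutFn_mem_FP fstF_mem_FP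
    (comp_mem_FP appendFn_mem_FP (fanoutFn_mem_FP fstF_mem_FP fstF_mem_FP))))

/-- **The transformation is polynomial time.** [cite: AroraBarakCC2009, §1.3] -/
theorem reduceFn_mem_FP : reduceFn ∈ FP := fanoutFn_mem_FP UF_mem_FP AF_mem_FP

/-- All emitted clause codes, clause by clause. [folklore] -/
def allCodes (w : List Bool) : List (List Bool) :=
  (List.range (fstF w).length).flatMap (clauseCodes w)

/-- The concatenated clause pieces are the code of the list of all clause codes. [folklore] -/
theorem ccat_clausePiece (w : List Bool) : ∀ n,
    ccat (fun j => clausePiece (boolPair w (ones j))) n = encList ((List.range n).flatMap (clauseCodes w))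
  | 0 => by simp
  | n + 1 => by
    rw [ccat_succ, ccat_clausePiece w n, List.range_succ, List.flatMap_append, List.flatMap_singleton,
      encList_append, clausePiece_boolPair]

/-- **Value of the clause fold**: the code of `allCodes w` (unclipping by `foldAcc_clipF`). [folklore] -/
theorem AF_apply (w : List Bool) : AF w = encList (allCodes w) := by
  have hk : (fstF w).length ≤ X.eval w.length := by
    rw [eval_X]; exact Lemma3FP.length_fstF_le w
  rw [AF, Function.comp_apply, Function.comp_apply, outInit_apply, foldLoop_apply _ _ hk, foldAcc_clipF,
    foldAcc_appF, List.nil_append]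
  · simp only [sndPow_succ_boolPair, sndPow_zero_boolPair, Nat.zero_add]
    exact ccat_clausePiece w _
  · intro j _ hj
    rw [Nat.zero_add] at hj
    exact length_clausePiece_le w hj

/-- The number of emitted clause codes: `3m`. [folklore] -/
theorem length_allCodes (w : List Bool) : (allCodes w).length = 3 * (fstF w).length := by
  unfold allCodes
  induction (fstF w).length with
  | zero => simp
  | succ n ih =>
    rw [List.range_succ, List.flatMap_append, List.length_append, ih, List.flatMap_singleton, length_clauseCodes]
    omega

/-- **Value of the header**: `1^{3m}`. [folklore] -/
theorem UF_apply (w : List Bool) : UF w = ones (allCodes w).length := by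
  simp only [UF, Function.comp_apply, fanoutFn_apply, appendFn_boolPair, onesFn_eq_ones, List.length_append,
    length_allCodes]
  congr 1; omega

/-- **The output decodes to the emitted clause codes, decoded** (its header announces exactly their
number). [folklore] -/
theorem decCNF_reduceFn (w : List Bool) : decCNF (reduceFn w) = (allCodes w).map decClause := by
  rw [reduceFn, fanoutFn_apply, UF_apply, AF_apply, decCNF, boolUnpair_boolPair, List.length_replicate,
    ← List.append_nil (encList (allCodes w)), decList_encList_append]

/-! ### The output is a code of `OneInThree.reduce` of the input -/

/-- **The clause codes of clause `i` decode to `clauseGadget 2^{|w|+1} i cᵢ`** for the decoded clause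
`cᵢ` (slots by `pad3_decClause_aOf`, fresh numerals by `zNum_eq`). [cite: GareyJohnson1979, LO4 (p. 259)] -/
theorem map_decClause_clauseCodes (w : List Bool) {i : ℕ} (hi : i < (fstF w).length) :
    (clauseCodes w i).map decClause = clauseGadget (2 ^ (w.length + 1)) i (decClause (aOf w i)) := by
  have z0 := zNum_eq w hi (show 0 ≤ 3 by omega)
  have z1 := zNum_eq w hi (show 1 ≤ 3 by omega)
  have z2 := zNum_eq w hi (show 2 ≤ 3 by omega)
  have z3 := zNum_eq w hi (show 3 ≤ 3 by omega)
  rw [Nat.add_zero] at z0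
  unfold clauseCodes clauseGadget
  by_cases h : fstF (aOf w i) = []
  · have hnil : decClause (aOf w i) = [] := (decClause_aOf_eq_nil_iff w i).2 h
    rw [if_pos h, hnil]
    simp only [pad3, unsatGadget, List.map_cons, List.map_nil, decClause_cl3, decLit_litC, z0, z1, z2,
      decode_encodeNat, decodeBool_singleton]
  · have hk : kOf w i ≠ 0 := by rwa [kOf_eq, Ne, List.length_eq_zero_iff]
    rw [if_neg h, pad3_decClause_aOf hk]
    simp only [gadget, List.map_cons, List.map_nil, decClause_cl3, decLit_litC, z0, z1, z2, z3,
      decode_encodeNat, decodeBool_singleton]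
    rfl

/-- **All emitted clause codes decode to `OneInThree.reduce 2^{|w|+1} (decCNF w)`** (induction over a
window of clause positions). [cite: GareyJohnson1979, LO4 (p. 259)] -/
theorem map_decClause_allCodes (w : List Bool) :
    (allCodes w).map decClause = reduce (2 ^ (w.length + 1)) (decCNF w) := by
  suffices h : ∀ (n i : ℕ), i + n ≤ (fstF w).length →
      ((List.range' i n).flatMap (clauseCodes w)).map decClause =
        reduceFrom (2 ^ (w.length + 1)) i (decList decClause n (sndF^[i] (sndF w))) by
    have := h (fstF w).length 0 (by omega)
    simpa [allCodes, List.range_eq_range', reduce, decCNF, fstF, sndF] using this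
  intro n
  induction n with
  | zero => intro i _; rfl
  | succ n ih =>
    intro i hi
    have h2 : (boolUnpair (sndF^[i] (sndF w))).2 = sndF^[i + 1] (sndF w) :=
      (Function.iterate_succ_apply' sndF i (sndF w)).symm
    have e1 : (boolUnpair (sndF^[i] (sndF w))).1 = aOf w i := rfl
    rw [List.range'_succ, List.flatMap_cons, List.map_append, ih (i + 1) (by omega), decList, reduceFrom,
      map_decClause_clauseCodes w (by omega), h2, e1]

/-- **Correctness of the machine on every string**: the output decodes to the transformation of the
decoded input with fresh block `2^{|w|+1}`. [cite: GareyJohnson1979, LO4 (p. 259)] -/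
theorem decCNF_reduceFn_eq_reduce (w : List Bool) : decCNF (reduceFn w) = reduce (2 ^ (w.length + 1)) (decCNF w) := by
  rw [decCNF_reduceFn, map_decClause_allCodes]

/-! ### The Karp reduction `kSAT 3 ≤ₚ ONEIN3SAT` -/

/-- **The reduction on codes**: a code of a 3CNF is sent to the canonical code of the transformation
of its decoding, every other string to `KSATRed.badCode`. [cite: GareyJohnson1979, LO4 (p. 259)] -/
def toX3SATFn : List Bool → List Bool :=
  iteFn (andFn KSATRed.isCanonFn (KSATRed.widthLEFn 3)) (KSATRed.canonCNFFn ∘ reduceFn) (fun _ => KSATRed.badCode)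

/-- `toX3SATFn ∈ FP`. [cite: AroraBarakCC2009, §1.3] -/
theorem toX3SATFn_mem_FP : toX3SATFn ∈ FP :=
  iteFn_mem_FP (andFn_mem_FP KSATRed.isCanonFn_mem_FP (KSATRed.widthLEFn_mem_FP 3))
    (comp_mem_FP KSATRed.canonCNFFn_mem_FP reduceFn_mem_FP) (const_mem_FP _)

/-- Value of `toX3SATFn` on a code. [folklore] -/
theorem toX3SATFn_encode (φ : CNF ℕ) :
    toX3SATFn (encodingCNF.encode φ) =
      if CNF.IsWidthLE 3 φ then
        encodingCNF.encode (reduce (2 ^ ((encodingCNF.encode φ).length + 1)) φ)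
      else KSATRed.badCode := by
  have hc : KSATRed.isCanonFn (encodingCNF.encode φ) = [true] := by
    rw [KSATRed.isCanonFn_apply, KSATRed.decCNF_encode]; simp
  rw [toX3SATFn, iteFn_apply (andFn_apply hc (KSATRed.widthLEFn_encode 3 φ))]
  by_cases h : CNF.IsWidthLE 3 φ
  · simp only [h, decide_true, Bool.true_and, if_true, Function.comp_apply, KSATRed.canonCNFFn_eq,
      decCNF_reduceFn_eq_reduce, KSATRed.decCNF_encode]
  · simp [h]

/-- Value of `toX3SATFn` on a non-code. [folklore] -/
theorem toX3SATFn_of_not_canon {x : List Bool} (hx : encodingCNF.encode (decCNF x) ≠ x) :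
    toX3SATFn x = KSATRed.badCode := by
  have hc : KSATRed.isCanonFn x = [false] := by rw [KSATRed.isCanonFn_apply]; simp [hx]
  obtain ⟨b, hb⟩ := KSATRed.oneBit_widthLEFn 3 x
  rw [toX3SATFn, iteFn_apply (andFn_apply hc hb)]
  simp

/-- `badCode ∉ ONEIN3SAT` (its clause is empty, not three literals). [folklore] -/
theorem badCode_not_mem_ONEIN3SAT : KSATRed.badCode ∉ ONEIN3SAT := fun h => by
  have h3 := ((mem_ONEIN3SAT_iff _).1 h).1 [] (List.mem_singleton_self _)
  simp at h3

/-- **`3SAT ≤ₚ ONE-IN-THREE 3SAT`** (Garey–Johnson [LO4]: "Transformation from 3SAT"; `3SAT = kSAT 3`,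
clauses of at most three literals, Arora–Barak Thm. 2.10 (2)). [cite: GareyJohnson1979, LO4 (p. 259)] -/
theorem kSAT_three_karpReducible_ONEIN3SAT : kSAT 3 ≤ₚ ONEIN3SAT := by
  refine ⟨toX3SATFn, toX3SATFn_mem_FP, fun x => ?_⟩
  show x ∈ kSAT 3 ↔ toX3SATFn x ∈ ONEIN3SAT
  by_cases hx : encodingCNF.encode (decCNF x) = x
  · have hb := decCNF_vars_lt (encodingCNF.encode (decCNF x))
    rw [KSATRed.decCNF_encode] at hb
    rw [← hx, toX3SATFn_encode, mem_kSAT_iff]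
    by_cases hW : CNF.IsWidthLE 3 (decCNF x)
    · rw [if_pos hW, reduce_mem_iff hW hb]
      exact ⟨fun h => h.2, fun h => ⟨hW, h⟩⟩
    · rw [if_neg hW]
      exact ⟨fun h => (hW h.1).elim, fun h => (badCode_not_mem_ONEIN3SAT h).elim⟩
  · rw [toX3SATFn_of_not_canon hx]
    exact ⟨fun h => (hx (KSATRed.encode_decCNF_of_mem h)).elim, fun h => (badCode_not_mem_ONEIN3SAT h).elim⟩

end OneInThree

/-! ### Discharge of the named fact -/

open OneInThree in
/-- **Discharge of `Schaefer1978_oneInThreeSAT_NPHard`** (`OneInThreeSAT.lean`): ONE-IN-THREE 3SAT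
is NP-hard — `3SAT` is NP-complete (`isNPComplete_kSAT_three_holds`, Arora–Barak Thm. 2.10 (2)) and
`kSAT 3 ≤ₚ ONEIN3SAT`, hardness propagating along the reduction (`IsHard.of_reducible_holds`).
[cite: GareyJohnson1979, LO4 (p. 259)] [cite: Schaefer1978, Thm. 2.1 (dichotomy; ONE-IN-THREE SAT)] -/
theorem Schaefer1978_oneInThreeSAT_NPHard_holds : Schaefer1978_oneInThreeSAT_NPHard := by
  have h : IsNPComplete (kSAT 3) := isNPComplete_kSAT_three_holds
  exact IsHard.of_reducible_holds h.isHard kSAT_three_karpReducible_ONEIN3SAT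

/-- With Schaefer's fact discharged, the tomography leaf needs only the circuit board:
`GGP1999_circuitBoard → GGP1999_twoDXRayNPHard`. [cite: GardnerGritzmann1999, Thm. 4.4.3 (proof)] -/
theorem GGP1999_twoDXRayNPHard_of_circuitBoard (h : GGP1999_circuitBoard) : GGP1999_twoDXRayNPHard :=
  GGP1999_twoDXRayNPHard_of Schaefer1978_oneInThreeSAT_NPHard_holds h

end Literature.Computability.Complexity
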